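import Literature.AlgebraicGeometry.Deformation.SmoothLiftLocalizationQuot
import Literature.AlgebraicGeometry.Deformation.SmoothLiftsIsomorphic
import Mathlib.RingTheory.Smooth.Basic
import HarnessLib

/-!
# Turnkey suppliers for the quotient-currency obstruction calculus: closed fibres through reductions, formal smoothness of
# restricted lifts, existence of gluings on overlaps ([Oort1971] Lemma (2.2.4); [Hartshorne2010] proof of Thm. 10.2 (a))

Layer `Literature/AlgebraicGeometry/Deformation`, namespace `Literature.AlgebraicGeometry.Deformation.LiftGluingSuppliersQuot`.
PROOF FILE, THEOREMS ONLY (no definition, no instance, no notation, no named fact, no `sorry`); ring level.  Last ring-level piece of the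
(U) = [Oort1971] (2.2.1) mixed-characteristic toolkit (★ `ExtensionIdealTensorClosedFibreQuot`, `ExtensionAutomorphismsClosedFibreQuot`,
`SmoothLiftObstructionCocycleQuot`, `SmoothLiftLocalizationQuot`, `DerivationsResidueQuot`): it turns the data a local lift ACTUALLY carries — its
REDUCTION `r : P ↠ Q = P ⧸ J P` onto a chart ring of the given scheme over `A' ⧸ J`, and that ring's closed fibre `π : Q ↠ B₀`, `ker π = 𝔪 Q` — into
the hypotheses the ★ (χ·)∕(c·)∕(l·) theorems consume, and supplies the GLUINGS on overlaps from ★ `SmoothLiftsIsomorphic` ([Oort1971] (2.2.4)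
«the lift is unique locally up to a (non-canonical) isomorphism»).

THE PRINT.  [Oort1971, Lemma (2.2.4), p. 274]: «For every `x ∈ X′` there exists an open neighbourhood `x ∈ U′ ⊂ X′` and a smooth morphism
`U → S = Spec (R)` such that `U ⊗_R R′ ≅ U′` … the lift is unique locally up to a (non-canonical) isomorphism.»  [Hartshorne2010, Thm. 10.2 (a),
proof, p. 81]: «Choose isomorphisms `φ_{ij} : U'_i|_{U_{ij}} ⥲ U'_j|_{U_{ij}}` for each `ij`» — the CHOICE this file makes available at ring level.

SETTING.  `A'` a commutative ring, `𝔪 J : Ideal A'` with `J ≤ 𝔪` (and `J` nilpotent where gluings are produced); `P` a lift with reduction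
`r : P →ₐ[A'] Q` onto, `RingHom.ker r = J.map (algebraMap A' P)`; `π : Q →ₐ[A'] B₀` onto, `RingHom.ker π = 𝔪.map (algebraMap A' Q)` (the closed fibre
of the chart ring `Q`).

* §1 (s1) **CLOSED FIBRE THROUGH THE REDUCTION**: `ρ := π.comp r` is onto with **`RingHom.ker (π.comp r) = 𝔪.map (algebraMap A' P)`** — the
  `hρ`∕`hker` of every ★ quotient-currency theorem, from `(r, π)`; `ρ`-compatibility of a gluing from its `r`-compatibility (`comp_compat`), and
  the symmetric compatibility of `ψ⁻¹` (`compat_symm`).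
* §2 (s2) **FORMAL SMOOTHNESS OF RESTRICTED LIFTS**: a localisation of a formally smooth `A'`-algebra is formally smooth over `A'` (Mathlib
  `Algebra.FormallySmooth.of_isLocalization` ∘ `.comp`; a theorem with the instances in binders, not an instance) — the hypothesis of ★ R2 on overlaps.
* §3 (s3) **GLUINGS EXIST** (`exists_gluing`): two lifts `S₁` (formally smooth) and `S₂` (flat) with reductions onto the SAME `Q` and kernels `J Sᵢ`,
  `J` nilpotent, are glued by some `ψ : S₁ ≃ₐ[A'] S₂` with `r₂ ∘ ψ = r₁` — ★ `StandardSmoothLift.exists_algEquiv_of_lifts` re-keyed in the (c1)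
  letters (smoothness on ONE side, flatness on the OTHER, as printed there).
* §4 (s4) **THE OVERLAP PACKAGE** (`exists_overlap_gluing`): for two charts `P₁, P₂` (reductions `rᵢ : Pᵢ ↠ Qᵢ`) and elements `bᵢ : Pᵢ` cutting out a
  common overlap ring `Q₁₂` (a localisation of `Q₁` away from `r₁ b₁` AND of `Q₂` away from `r₂ b₂`), the restricted lifts `Sᵢ = Pᵢ[1/bᵢ]` come
  with reductions `rSᵢ : Sᵢ ↠ Q₁₂` (kernels `J Sᵢ`, ★ `LiftLocalizationQuot`) and a gluing `ψ : S₁ ≃ₐ[A'] S₂`, `rS₂ ∘ ψ = rS₁` — the datum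
  «`φ_{ij} : U'_i|_{U_{ij}} ⥲ U'_j|_{U_{ij}}`» that ★ `SmoothLiftObstructionCocycleQuot` reads.

Cell `hodgecm-mathlib`, P6 sub-desk P6b, LEAD word «M-122» deal #5 (U-sup): generic organ capital on the road to (U) =
`Cruxes/HLiu418/Lines/F0_P6b_BTSerreTate.stub_L4B1u_abelianLiftOfIsUnitTwo` (banked); count-neutral.  HC_CM is proved only modulo the printed citations
until rung 0 closes; nothing here bears on a summit statement.

## References
* [Oort1971] F. Oort, *Finite group schemes, local moduli for abelian varieties, and lifting problems*, Compositio Math. 23 (1971),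
  Lemma (2.2.4) (p. 274), §2.2 (pp. 277–279).
* [Hartshorne2010] R. Hartshorne, *Deformation Theory*, GTM 257, Springer (2010): Prop. 2.2 (p. 10), Thm. 10.2 (a) and its proof (p. 81).
* [StacksProject] The Stacks Project, Tag 00CM (localisation), Tag 00CP (maps out of a localisation), Tag 04EG (localisation is formally étale) with Tag 031H (composition of formally smooth maps).
-/

noncomputable section

namespace Literature.AlgebraicGeometry.Deformation.LiftGluingSuppliersQuot

open Literature.AlgebraicGeometry.Deformation.LiftLocalizationQuot Literature.AlgebraicGeometry.Deformation.StandardSmoothLift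

variable {A' : Type*} [CommRing A']
variable {P : Type*} [CommRing P] [Algebra A' P]
variable {Q : Type*} [CommRing Q] [Algebra A' Q]
variable {B₀ : Type*} [CommRing B₀] [Algebra A' B₀]

/-! ## §1 (s1) The closed fibre of a lift through its reduction -/

/-- **`ker (π ∘ r) = 𝔪 P`:** for the reduction `r : P ↠ Q` (`ker r = J P`) and the closed fibre `π : Q ↠ B₀` of the chart ring (`ker π = 𝔪 Q`), with
`J ⊆ 𝔪`: the composite `ρ = π ∘ r : P ↠ B₀` has kernel `r⁻¹(𝔪 Q) = 𝔪 P + J P = 𝔪 P` — the hypothesis `hker` of the ★ quotient-currency theorems.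
[cite: Oort1971, Lemma (2.2.4) (p. 274)] [cite: Hartshorne2010, Thm. 10.2 (a) (proof), p. 81] -/
theorem ker_comp_eq_map (𝔪 J : Ideal A') (hJ𝔪 : J ≤ 𝔪) (r : P →ₐ[A'] Q) (hr : Function.Surjective r)
    (hkr : RingHom.ker r = J.map (algebraMap A' P)) (π : Q →ₐ[A'] B₀) (hkπ : RingHom.ker π = 𝔪.map (algebraMap A' Q)) :
    RingHom.ker (π.comp r) = 𝔪.map (algebraMap A' P) := by
  have hkπ' : RingHom.ker (π : Q →+* B₀) = 𝔪.map (algebraMap A' Q) := hkπ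
  have hkr' : RingHom.ker (r : P →+* Q) = J.map (algebraMap A' P) := hkr
  have hr' : Function.Surjective (r : P →+* Q) := hr
  change RingHom.ker ((π : Q →+* B₀).comp (r : P →+* Q)) = _
  rw [← RingHom.comap_ker, hkπ', ← AlgHom.comp_algebraMap r, ← Ideal.map_map, Ideal.comap_map_of_surjective _ hr',
    ← RingHom.ker_eq_comap_bot, hkr']
  exact sup_eq_left.mpr (Ideal.map_mono hJ𝔪)

omit [Algebra A' P] [Algebra A' Q] [Algebra A' B₀] in
/-- `π ∘ r` is onto. [cite: Oort1971, Lemma (2.2.4) (p. 274)] -/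
theorem surjective_comp [Algebra A' P] [Algebra A' Q] [Algebra A' B₀] (r : P →ₐ[A'] Q) (hr : Function.Surjective r)
    (π : Q →ₐ[A'] B₀) (hπ : Function.Surjective π) : Function.Surjective (π.comp r) :=
  hπ.comp hr

/-- **`ρ`-compatibility from `r`-compatibility:** if a gluing `ψ : P₁ → P₂` commutes with the reductions onto `Q` then it commutes with the closed
fibres `π ∘ rᵢ` — the hypothesis `hψ` ∕ `ρⱼ ∘ ψᵢⱼ = ρᵢ` of ★ `SmoothLiftObstructionCocycleQuot`. [cite: Hartshorne2010, Thm. 10.2 (a) (proof), p. 81] -/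
theorem comp_compat {P₂ : Type*} [CommRing P₂] [Algebra A' P₂] (r₁ : P →ₐ[A'] Q) (r₂ : P₂ →ₐ[A'] Q)
    (π : Q →ₐ[A'] B₀) {F : Type*} [FunLike F P P₂] (ψ : F) (h : ∀ x, r₂ (ψ x) = r₁ x) (x : P) :
    (π.comp r₂) (ψ x) = (π.comp r₁) x := by
  rw [AlgHom.comp_apply, AlgHom.comp_apply, h]

/-- Compatibility of the inverse gluing: `r₂ ∘ ψ = r₁` gives `r₁ ∘ ψ⁻¹ = r₂`. [cite: Hartshorne2010, Thm. 10.2 (a) (proof), p. 81] -/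
theorem compat_symm {P₂ : Type*} [CommRing P₂] [Algebra A' P₂] {C : Type*} (r₁ : P → C) (r₂ : P₂ → C)
    (ψ : P ≃ₐ[A'] P₂) (h : ∀ x, r₂ (ψ x) = r₁ x) (y : P₂) : r₁ (ψ.symm y) = r₂ y := by
  rw [← h, AlgEquiv.apply_symm_apply]

/-! ## §2 (s2) Restricted lifts stay formally smooth -/

/-- **A localisation of a formally smooth `A'`-algebra is formally smooth over `A'`** (formally smooth over `P` by Mathlib
`Algebra.FormallySmooth.of_isLocalization`, then `Algebra.FormallySmooth.comp`) — so ★ R2 `exists_algEquiv_of_lifts` applies to lifts restricted to an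
overlap; a theorem with the instances in its binders, not an instance. [cite: StacksProject, Tag 04EG; Tag 031H] [cite: Oort1971, Lemma (2.2.4) (p. 274)] -/
theorem formallySmooth_of_isLocalization {S : Type*} [CommRing S] [Algebra P S] [Algebra A' S] [IsScalarTower A' P S]
    (M : Submonoid P) [IsLocalization M S] [Algebra.FormallySmooth A' P] : Algebra.FormallySmooth A' S := by
  haveI : Algebra.FormallySmooth P S := Algebra.FormallySmooth.of_isLocalization M
  exact Algebra.FormallySmooth.comp A' P S

/-! ## §3 (s3) Gluings exist on overlaps -/

/-- **GLUINGS EXIST** ([Oort1971] (2.2.4) «unique locally up to a (non-canonical) isomorphism», ★ `StandardSmoothLift.exists_algEquiv_of_lifts` in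
the (c1) letters): `J` nilpotent; `S₁` FORMALLY SMOOTH and `S₂` FLAT over `A'`, with reductions `rᵢ : Sᵢ ↠ Q` onto the SAME `Q`,
`ker rᵢ = J Sᵢ`; then there is `ψ : S₁ ≃ₐ[A'] S₂` with `r₂ ∘ ψ = r₁` — «choose isomorphisms `φ_{ij}`».
[cite: Oort1971, Lemma (2.2.4) (p. 274)] [cite: Hartshorne2010, Thm. 10.2 (a) (proof), p. 81] -/
theorem exists_gluing {S₁ : Type*} [CommRing S₁] [Algebra A' S₁] {S₂ : Type*} [CommRing S₂] [Algebra A' S₂]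
    {J : Ideal A'} (hJ : IsNilpotent J) [Algebra.FormallySmooth A' S₁] [Module.Flat A' S₂]
    (r₁ : S₁ →ₐ[A'] Q) (hr₁ : Function.Surjective r₁) (hkr₁ : RingHom.ker r₁ = J.map (algebraMap A' S₁))
    (r₂ : S₂ →ₐ[A'] Q) (hr₂ : Function.Surjective r₂) (hkr₂ : RingHom.ker r₂ = J.map (algebraMap A' S₂)) :
    ∃ ψ : S₁ ≃ₐ[A'] S₂, ∀ x, r₂ (ψ x) = r₁ x :=
  exists_algEquiv_of_lifts hJ r₁ hr₁ hkr₁.le r₂ hr₂ hkr₂.le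

/-- The glued discrepancy hypothesis: for three lifts with reductions onto the same `Q` and gluings from `exists_gluing`, the discrepancy
`ψ₁₃⁻¹ ψ₂₃ ψ₁₂` lies over the identity of `S₁ ⧸ J S₁` — ★ `LiftObstructionCocycleQuot.trans_trans_symm_sub_mem`, restated here for the record with the
supplier's outputs as inputs. [cite: Hartshorne2010, Thm. 10.2 (a) (proof), p. 81] -/
theorem gluing_discrepancy_sub_mem {S₁ : Type*} [CommRing S₁] [Algebra A' S₁] {S₂ : Type*} [CommRing S₂] [Algebra A' S₂]
    {S₃ : Type*} [CommRing S₃] [Algebra A' S₃] (J : Ideal A')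
    (r₁ : S₁ →ₐ[A'] Q) (r₂ : S₂ →ₐ[A'] Q) (r₃ : S₃ →ₐ[A'] Q) (hkr₁ : RingHom.ker r₁ = J.map (algebraMap A' S₁))
    (ψ₁₂ : S₁ ≃ₐ[A'] S₂) (ψ₂₃ : S₂ ≃ₐ[A'] S₃) (ψ₁₃ : S₁ ≃ₐ[A'] S₃)
    (h₁₂ : ∀ x, r₂ (ψ₁₂ x) = r₁ x) (h₂₃ : ∀ x, r₃ (ψ₂₃ x) = r₂ x) (h₁₃ : ∀ x, r₃ (ψ₁₃ x) = r₁ x) (x : S₁) :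
    (ψ₁₂.trans (ψ₂₃.trans ψ₁₃.symm)) x - x ∈ J • (⊤ : Submodule A' S₁) :=
  LiftObstructionCocycleQuot.trans_trans_symm_sub_mem J r₁ r₂ r₃ hkr₁ ψ₁₂ ψ₂₃ ψ₁₃ h₁₂ h₂₃ h₁₃ x

/-! ## §4 (s4) The overlap package -/

/-- **THE OVERLAP PACKAGE** («`φ_{ij} : U'_i|_{U_{ij}} ⥲ U'_j|_{U_{ij}}`», ring level): two charts `P₁` (formally smooth) and `P₂` (flat) over `A'` with
reductions `rᵢ : Pᵢ ↠ Qᵢ` (`ker rᵢ = J Pᵢ`, `J` nilpotent), elements `bᵢ : Pᵢ`, restricted lifts `Sᵢ = Pᵢ[1/bᵢ]`, and a COMMON overlap ring `Q₁₂`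
that is the localisation of `Q₁` away from `r₁ b₁` and of `Q₂` away from `r₂ b₂` (as `Γ(X₀, U₁ ∩ U₂)` is, for `U₁ ∩ U₂ = D(b̄₁) = D(b̄₂)`): THEN there
are reductions `rSᵢ : Sᵢ →ₐ[A'] Q₁₂` (`rSᵢ (x/1) = rᵢ(x)/1`), onto, with `ker rSᵢ = J Sᵢ`, and a gluing `ψ : S₁ ≃ₐ[A'] S₂` with `rS₂ ∘ ψ = rS₁` —
the input of ★ `SmoothLiftObstructionCocycleQuot` on this overlap (★ `LiftLocalizationQuot` §1–§2, §2–§3 above).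
[cite: Oort1971, Lemma (2.2.4) (p. 274)] [cite: Hartshorne2010, Thm. 10.2 (a) (proof), p. 81] [cite: StacksProject, Tag 00CP] -/
theorem exists_overlap_gluing {J : Ideal A'} (hJ : IsNilpotent J)
    {P₁ : Type*} [CommRing P₁] [Algebra A' P₁] [Algebra.FormallySmooth A' P₁]
    {P₂ : Type*} [CommRing P₂] [Algebra A' P₂] [Module.Flat A' P₂]
    {Q₁ : Type*} [CommRing Q₁] [Algebra A' Q₁] {Q₂ : Type*} [CommRing Q₂] [Algebra A' Q₂]
    (r₁ : P₁ →ₐ[A'] Q₁) (hr₁ : Function.Surjective r₁) (hkr₁ : RingHom.ker r₁ = J.map (algebraMap A' P₁))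
    (r₂ : P₂ →ₐ[A'] Q₂) (hr₂ : Function.Surjective r₂) (hkr₂ : RingHom.ker r₂ = J.map (algebraMap A' P₂))
    (b₁ : P₁) (b₂ : P₂)
    {S₁ : Type*} [CommRing S₁] [Algebra P₁ S₁] [Algebra A' S₁] [IsScalarTower A' P₁ S₁] [IsLocalization.Away b₁ S₁]
    {S₂ : Type*} [CommRing S₂] [Algebra P₂ S₂] [Algebra A' S₂] [IsScalarTower A' P₂ S₂] [IsLocalization.Away b₂ S₂]
    {Q₁₂ : Type*} [CommRing Q₁₂] [Algebra A' Q₁₂] [Algebra Q₁ Q₁₂] [IsScalarTower A' Q₁ Q₁₂] [IsLocalization.Away (r₁ b₁) Q₁₂]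
    [Algebra Q₂ Q₁₂] [IsScalarTower A' Q₂ Q₁₂] [IsLocalization.Away (r₂ b₂) Q₁₂] :
    ∃ (rS₁ : S₁ →ₐ[A'] Q₁₂) (rS₂ : S₂ →ₐ[A'] Q₁₂) (ψ : S₁ ≃ₐ[A'] S₂),
      (∀ x, rS₁ (algebraMap P₁ S₁ x) = algebraMap Q₁ Q₁₂ (r₁ x)) ∧ (∀ x, rS₂ (algebraMap P₂ S₂ x) = algebraMap Q₂ Q₁₂ (r₂ x)) ∧
      Function.Surjective rS₁ ∧ Function.Surjective rS₂ ∧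
      RingHom.ker rS₁ = J.map (algebraMap A' S₁) ∧ RingHom.ker rS₂ = J.map (algebraMap A' S₂) ∧
      ∀ x, rS₂ (ψ x) = rS₁ x := by
  obtain ⟨rS₁, hS₁⟩ := exists_algHom_away (S := S₁) (B' := Q₁₂) r₁ b₁
  obtain ⟨rS₂, hS₂⟩ := exists_algHom_away (S := S₂) (B' := Q₁₂) r₂ b₂
  have hsurj₁ := surjective_algHom_away r₁ hr₁ b₁ rS₁ hS₁
  have hsurj₂ := surjective_algHom_away r₂ hr₂ b₂ rS₂ hS₂
  have hk₁ := ker_algHom_away J r₁ hkr₁ b₁ rS₁ hS₁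
  have hk₂ := ker_algHom_away J r₂ hkr₂ b₂ rS₂ hS₂
  haveI : Algebra.FormallySmooth A' S₁ := formallySmooth_of_isLocalization (Submonoid.powers b₁)
  haveI : Module.Flat A' S₂ := flat_of_isLocalization (Submonoid.powers b₂)
  obtain ⟨ψ, hψ⟩ := exists_gluing hJ rS₁ hsurj₁ hk₁ rS₂ hsurj₂ hk₂
  exact ⟨rS₁, rS₂, ψ, hS₁, hS₂, hsurj₁, hsurj₂, hk₁, hk₂, hψ⟩

end Literature.AlgebraicGeometry.Deformation.LiftGluingSuppliersQuot

end
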